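import Literature.NumberTheory.GaloisCohomology.Howard2004.TowerSelmerLiftGlobalDualityProofs
import Literature.NumberTheory.GaloisCohomology.PairingTateDual
import Literature.NumberTheory.GaloisRepresentations.ContinuousCupProductCompat
import HarnessLib

/-!
# Howard 2004, Prop. 1.4.1 — the RIGHT-orthogonality «`π^s H¹_{𝓕*}(K, T*[𝔪^{s+1}])` pairs to zero» of the
# Poitou–Tate value, in Tate-dual currency (the transpose `ι^D` and its adjunction; pairing-free) — proofs file

Topic `NumberTheory/GaloisCohomology/Howard2004`. THEOREMS ONLY: no definition, no named fact, no instance, no notation,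
no `sorry`.  Cell `pub/bsd-print-x9` (seat x10b-p1-w8 g12, brick «C451-CL Q5-DUAL» of LEAD g14's class-level port plan,
`--supports stmt-BirchSwinnertonDyer-22642`; print leaf G87 ↦ the «Flach leaf» C45.1′ / C45.1″).  Sequel of
`TowerSelmerLiftGlobalDualityProofs` (LIFT-PT) / `TowerSelmerLiftPairingWellDefinedProofs` (LIFT-WD): the VALUE of the class-level
pairing is `Q(a)(y) = ∑_{v ∈ Σ} inv_v(m_v ∪ loc_v y)` (`m` the local defects of a global lift `ã`); HERE it is shown to vanish on
the image of the TRANSPOSE `ι^D : T^{(t+1)*} → T^{(0)*}` of the kernel presentation `ι : T^{(0)} → T^{(t+1)}` applied to the dual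
Selmer group of level `t+1` — Howard's «on the right the image of `π^s : H¹_{𝓕*}(K, T*[𝔪^{s+t}]) → H¹_{𝓕*}(K, T*[𝔪^t])`» pairs to
zero (the easy inclusion of the right kernel; Morgan–Smith: `CTP(a, ι^∨ y′) = 0`).  The identification of this image with
`red^{t+1}(𝓗_{t+1}(n))` under H.4 (`Ψ`, brick Q4) is NOT done here.

SOURCE. B. Howard, *The Heegner point Kolyvagin system*, Compositio Math. **140** (2004) = arXiv:1202.6340, Prop. 1.4.1 (p0008
L83–98); A. Morgan, A. Smith, arXiv:2103.08530, Prop. 3.3 / Thm. 1.3 (the right kernel contains `ι^∨(Sel M^∨)`); J. Neukirch,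
A. Schmidt, K. Wingberg, *Cohomology of Number Fields*, I §4 (1.4.2) (adjoint naturality of the cup product).

WHAT IS PROVED (a `DVRSetting` `S`, levels `0`, `t+1`; `ι : N_0 →ₗ N_{t+1}` equivariant; a level `n₀`).
* §1 THE TRANSPOSE.  With `B_ι := (x₀, f) ↦ f(ι x₀) : N_0 × N_{t+1}^D → μ_{n₀}` (`tateDualEval ∘ ι`, equivariant:
  `pairing_transpose_smul`), the tree's `pairingDualHom n₀ B_ι : N_{t+1}^D → N_0^D` IS `f ↦ f ∘ ι` (definitionally)
  and is `Γ_K`-equivariant (`pairingDualHom_smul`); **`localTatePairing_transpose`** — the adjunction at every place: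
  `⟨m, H¹_v(ι^D) y⟩_{N_0} = ⟨H¹_v(ι) m, y⟩_{N_{t+1}}` (`ContPairing.cupProduct_adjoint`).
* §2 **`sum_localTatePairingZMod_defects_transpose_eq_zero`** — for local defects `(m_v)` of a global `ã ∈ H¹(K, N_{t+1})`
  (`loc_v ã - ℓ_v = ι_v m_v`, `ℓ_v ∈ 𝓕(n)_{t+1,v}`, `m` supported on `Σ`) and every GLOBAL `y′ ∈ H¹_{𝓕(n)_{t+1}^*}(K, N_{t+1}^D)`:
  `∑_{v ∈ Σ} inv_v(m_v ∪ loc_v(H¹(ι^D) y′)) = 0` — termwise `= ⟨loc_v ã - ℓ_v, y′_v⟩_v = ⟨loc_v ã, y′_v⟩_v` (`ℓ_v ⊥ y′_v`), and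
  `∑_v ⟨ã_v, y′_v⟩_v = 0` by the reciprocity law (`SumLocalTermEqZero`; off `Σ`, `loc_v ã = ℓ_v ∈ 𝓕(n)_{t+1,v}`).

HONEST FRAMING: no pairing is constructed; Prop. 1.4.1, C45.1′/C45.1″ and `thm161_dvrKolyvaginBound` are NOT proved; no summit
statement is proved; the Birch–Swinnerton-Dyer conjecture is not proved by any of this.
-/

set_option autoImplicit false

noncomputable section

namespace Literature.NumberTheory.GaloisCohomology.Howard2004

open Function NumberField IsDedekindDomain Field CategoryTheory
open scoped NumberField ContRepresentation
open Literature.NumberTheory.GaloisRepresentations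
open Literature.NumberTheory.GaloisRepresentations.DiscreteGaloisModule
open Literature.NumberTheory.GaloisCohomology (LocalInvariants)

namespace DVRSetting

variable {p : ℕ} [Fact p.Prime] {K : Type} [Field K] [NumberField K]
  {R : Type} [CommRing R] [IsDomain R] [IsDiscreteValuationRing R] [Algebra ℤ_[p] R]
  {N : ℕ → Type} [∀ k, AddCommGroup (N k)] [∀ k, TopologicalSpace (N k)]
  [∀ k, DiscreteTopology (N k)] [∀ k, Module R (N k)]
  {Rk : ℕ → Type} [∀ k, CommRing (Rk k)] [∀ k, IsLocalRing (Rk k)] [∀ k, TopologicalSpace (Rk k)]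
  [∀ k, DiscreteTopology (Rk k)] [∀ k, Algebra ℤ_[p] (Rk k)] [∀ k, Algebra R (Rk k)]
  [∀ k, Module (Rk k) (N k)] [∀ k, IsScalarTower R (Rk k) (N k)]
  {Nbar : Type} [AddCommGroup Nbar] [TopologicalSpace Nbar] [DiscreteTopology Nbar]
  [∀ k, Module (Rk k) Nbar]
  {Nq : ℕ → Finset (HeightOneSpectrum (𝓞 K)) → Type} [∀ k n, AddCommGroup (Nq k n)]
  [∀ k n, TopologicalSpace (Nq k n)] [∀ k n, DiscreteTopology (Nq k n)]
  [∀ k n, Module (Rk k) (Nq k n)] [∀ k n, Module R (Nq k n)]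
  [∀ k n, IsScalarTower R (Rk k) (Nq k n)]

/-! ## §1 The transpose `ι^D : T^{(t+1)*} → T^{(0)*}` and its adjunction with the local Tate pairings -/

/-- **The pairing `B_ι(x₀, f) = f(ι x₀) : T^{(0)} × T^{(t+1)*} → μ_{n₀}` is `Γ_K`-equivariant** (evaluation is, and `ι`
intertwines). [cite: MilneADT2006, Ch. I §2 (M^D and the evaluation pairing)] -/
theorem pairing_transpose_smul [∀ k, Finite (N k)] (S : DVRSetting p K R N Rk Nbar Nq) {t : ℕ} (n₀ : ℕ)
    (ι : N 0 →ₗ[R] N (t + 1))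
    (hιg : ∀ (g : absoluteGaloisGroup K) (x : N 0), ι (S.T.ρ 0 g x) = S.T.ρ (t + 1) g (ι x))
    (σ : absoluteGaloisGroup K) (x : N 0) (f : TateDual K (N (t + 1)) n₀) :
    ((tateDualEval K (N (t + 1)) n₀).comp ι.toAddMonoidHom) (S.T.ρ 0 σ x)
        ((S.T.ρ (t + 1)).tateDual n₀ σ f) =
      mu K n₀ σ (((tateDualEval K (N (t + 1)) n₀).comp ι.toAddMonoidHom) x f) := by
  rw [AddMonoidHom.comp_apply, AddMonoidHom.comp_apply, LinearMap.toAddMonoidHom_coe, hιg]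
  exact tateDualEval_smul (S.T.ρ (t + 1)) n₀ σ (ι x) f

/-- **Adjunction of the transpose with the local Tate pairings**: at every place `v`, for `m ∈ H¹(K_v, T^{(0)})` and
`y ∈ H¹(K_v, T^{(t+1)*})`, `⟨m, H¹_v(ι^D) y⟩_{T^{(0)}} = ⟨H¹_v(ι) m, y⟩_{T^{(t+1)}}` in `H²(K_v, μ_{n₀})` (adjoint naturality of the
cup product). [cite: NeukirchSchmidtWingberg2008, I §4 (1.4.2)] [cite: MilneADT2006, Ch. I Cor. 2.3] -/
theorem localTatePairing_transpose [∀ k, Finite (N k)] (S : DVRSetting p K R N Rk Nbar Nq) {t : ℕ} (n₀ : ℕ)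
    (ι : N 0 →ₗ[R] N (t + 1))
    (hιg : ∀ (g : absoluteGaloisGroup K) (x : N 0), ι (S.T.ρ 0 g x) = S.T.ρ (t + 1) g (ι x))
    (v : Place K) (m : galoisCohomology ((S.T.ρ 0).toLocal v) 1)
    (y : galoisCohomology (((S.T.ρ (t + 1)).tateDual n₀).toLocal v) 1) :
    localTatePairing (S.T.ρ 0) n₀ v m
        (ContinuousRep.cohomologyMap (((S.T.ρ (t + 1)).tateDual n₀).toLocal v) (((S.T.ρ 0).tateDual n₀).toLocal v)
          (pairingDualHom n₀ ((tateDualEval K (N (t + 1)) n₀).comp ι.toAddMonoidHom)) continuous_of_discreteTopology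
          (fun _ f => pairingDualHom_smul (S.pairing_transpose_smul n₀ ι hιg) _ f) 1 y) =
      localTatePairing (S.T.ρ (t + 1)) n₀ v
        (ContinuousRep.cohomologyMap ((S.T.ρ 0).toLocal v) ((S.T.ρ (t + 1)).toLocal v) ι.toAddMonoidHom
          continuous_of_discreteTopology (fun _ x => hιg _ x) 1 m) y := by
  haveI : CompactSpace (absoluteGaloisGroup (Place.Completion v)) := absoluteGaloisGroup_compactSpace _
  have h := ContPairing.cupProduct_adjoint (tateDualPairingLocal (S.T.ρ 0) n₀ v) (tateDualPairingLocal (S.T.ρ (t + 1)) n₀ v)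
    (TopRep.ofHom ⟨⟨ι.toAddMonoidHom.toIntLinearMap, continuous_of_discreteTopology⟩,
      fun g => ContinuousLinearMap.ext fun x => hιg _ x⟩)
    (TopRep.ofHom ⟨⟨(pairingDualHom n₀ ((tateDualEval K (N (t + 1)) n₀).comp ι.toAddMonoidHom)).toIntLinearMap,
        continuous_of_discreteTopology⟩,
      fun g => ContinuousLinearMap.ext fun f => pairingDualHom_smul (S.pairing_transpose_smul n₀ ι hιg) _ f⟩)
    (fun _ _ => rfl) m y
  exact h.symm

/-! ## §2 The Poitou–Tate value vanishes on `ι^D` of the dual Selmer group of level `t + 1` -/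

/-- **RIGHT-orthogonality of the Poitou–Tate value (Tate-dual currency).**  Let `ι : T^{(0)} → T^{(t+1)}` be `Γ_K`-equivariant,
`ã ∈ H¹(K, T^{(t+1)})` a global class with local defects `m_v ∈ H¹(K_v, T^{(0)})` (`loc_v ã - ℓ_v = H¹_v(ι) m_v`,
`ℓ_v ∈ 𝓕(n)_{t+1,v}`) supported on a finite set of places `Σ`, and `inv` a family of local invariant maps at a level `n₀` killing
`T^{(t+1)}` with the reciprocity law (`SumLocalTermEqZero`).  Then for every `y′ ∈ H¹_{𝓕(n)_{t+1}^*}(K, T^{(t+1)*})`: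
`∑_{v ∈ Σ} inv_v(m_v ∪ loc_v(H¹(ι^D) y′)) = 0` — the value `Q(a)` kills `ι^D` of the level-`t+1` dual Selmer group («on the
right the image of `π^s`», the easy inclusion).  Termwise `⟨m_v, (ι^D y′)_v⟩ = ⟨ι m_v, y′_v⟩ = ⟨ã_v, y′_v⟩ - ⟨ℓ_v, y′_v⟩ = ⟨ã_v, y′_v⟩`,
and `∑_v ⟨ã_v, y′_v⟩ = 0` (reciprocity; off `Σ`, `ã_v = ℓ_v ⊥ y′_v`).
[cite: Howard2004HeegnerKolyvagin, Prop. 1.4.1 (arXiv:1202.6340 p0008 L83–98) and Thm. 1.1.11]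
[cite: MilneADT2006, Ch. I, Thm. 4.10] [cite: NeukirchSchmidtWingberg2008, I §4 (1.4.2)] -/
theorem sum_localTatePairingZMod_defects_transpose_eq_zero [∀ k, Finite (N k)] (S : DVRSetting p K R N Rk Nbar Nq)
    {t : ℕ} (n : Finset (HeightOneSpectrum (𝓞 K))) (ι : N 0 →ₗ[R] N (t + 1))
    (hιg : ∀ (g : absoluteGaloisGroup K) (x : N 0), ι (S.T.ρ 0 g x) = S.T.ρ (t + 1) g (ι x))
    {n₀ : ℕ} [NeZero n₀] (hM : ∀ x : N (t + 1), n₀ • x = 0) (inv : LocalInvariants K n₀) (hPT : inv.SumLocalTermEqZero)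
    (Sfin : Finset (Place K)) (ã : galoisCohomology (S.T.ρ (t + 1)) 1)
    (m : ∀ v : Place K, galoisCohomology ((S.T.ρ 0).toLocal v) 1)
    (hm : ∀ v, ∃ ℓ ∈ ((S.t (t + 1)).atLevel S.jbar n).cond v,
      galoisCohomology.localization (S.T.ρ (t + 1)) v 1 ã - ℓ =
        ContinuousRep.cohomologyMap ((S.T.ρ 0).toLocal v) ((S.T.ρ (t + 1)).toLocal v) ι.toAddMonoidHom
          continuous_of_discreteTopology (fun _ x => hιg _ x) 1 (m v))
    (hmS : ∀ v ∉ Sfin, m v = 0)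
    {y' : galoisCohomology ((S.T.ρ (t + 1)).tateDual n₀) 1}
    (hy' : y' ∈ (inv.dualSelmerStructure (S.T.ρ (t + 1)) ((S.t (t + 1)).atLevel S.jbar n).cond).selmerGroup) :
    ∑ v ∈ Sfin, localTatePairingZMod (S.T.ρ 0) n₀ v (inv v) (m v)
        (galoisCohomology.localization ((S.T.ρ 0).tateDual n₀) v 1
          (ContinuousRep.cohomologyMap ((S.T.ρ (t + 1)).tateDual n₀) ((S.T.ρ 0).tateDual n₀)
            (pairingDualHom n₀ ((tateDualEval K (N (t + 1)) n₀).comp ι.toAddMonoidHom)) continuous_of_discreteTopology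
            (pairingDualHom_smul (S.pairing_transpose_smul n₀ ι hιg)) 1 y')) = 0 := by
  classical
  set 𝓕 : SelmerStructure (S.T.ρ (t + 1)) := ((S.t (t + 1)).atLevel S.jbar n).cond with h𝓕
  have hyv : ∀ v, galoisCohomology.localization ((S.T.ρ (t + 1)).tateDual n₀) v 1 y' ∈
      inv.dualLocalCondition (S.T.ρ (t + 1)) v (𝓕 v) := fun v => (SelmerStructure.mem_selmerGroup_iff _ _).1 hy' v
  -- termwise: `⟨m_v, (ι^D y')_v⟩ = ⟨ã_v, y'_v⟩`
  have hterm : ∀ v, localTatePairingZMod (S.T.ρ 0) n₀ v (inv v) (m v)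
        (galoisCohomology.localization ((S.T.ρ 0).tateDual n₀) v 1
          (ContinuousRep.cohomologyMap ((S.T.ρ (t + 1)).tateDual n₀) ((S.T.ρ 0).tateDual n₀)
            (pairingDualHom n₀ ((tateDualEval K (N (t + 1)) n₀).comp ι.toAddMonoidHom)) continuous_of_discreteTopology
            (pairingDualHom_smul (S.pairing_transpose_smul n₀ ι hιg)) 1 y')) =
      inv.localTerm (S.T.ρ (t + 1)) v ã y' := by
    intro v
    obtain ⟨ℓ, hℓ, hℓeq⟩ := hm v
    rw [localTatePairingZMod_apply, localization_cohomologyMap_one, S.localTatePairing_transpose n₀ ι hιg v, ← hℓeq,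
      map_sub, AddMonoidHom.sub_apply, LocalInvariants.localTerm_apply]
    -- `⟨ℓ_v, y'_v⟩ = 0`
    have h0 : localTatePairingZMod (S.T.ρ (t + 1)) n₀ v (inv v) ℓ
        (galoisCohomology.localization ((S.T.ρ (t + 1)).tateDual n₀) v 1 y') = 0 :=
      (LocalInvariants.mem_dualLocalCondition_iff _ _ _ _ _).1 (hyv v) ℓ hℓ
    rw [localTatePairingZMod_apply] at h0
    rw [map_sub, h0, sub_zero]
  simp_rw [hterm]
  refine hPT (S.T.ρ (t + 1)) hM ã y' Sfin fun v hv => ?_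
  -- off `Σ`: `loc_v ã = ℓ_v ∈ 𝓕(n)_{t+1,v}`
  obtain ⟨ℓ, hℓ, hℓeq⟩ := hm v
  rw [hmS v hv] at hℓeq
  have h1 : galoisCohomology.localization (S.T.ρ (t + 1)) v 1 ã = ℓ := by
    rw [← sub_eq_zero, hℓeq]
    exact map_zero _
  have hã : galoisCohomology.localization (S.T.ρ (t + 1)) v 1 ã ∈ 𝓕 v := by rw [h1]; exact hℓ
  exact inv.localTerm_eq_zero_of_mem_of_mem_dual (S.T.ρ (t + 1)) v (𝓕 v) hã (hyv v)

end DVRSetting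

end Literature.NumberTheory.GaloisCohomology.Howard2004

end
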